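import Summits.AtomisticToContinuum.FouriersLaw.Theses.EmbeddedDrudeMourre
import Summits.AtomisticToContinuum.FouriersLaw.Theorems.EmbeddedDrudeMourreDrudeDissolutionStubRichFramework
import HarnessLib

/-!
# The rich symmetric zero-wavenumber framework — stub `stub_framework` (B′) of line `parity-count-second-quantised-fgr`
(crux `EmbeddedDrudeMourre.MourreDissolution`, item stmt-AtomisticToContinuum-12594; helper file, `--supports`)

Registered stub B′ of the checked skeleton of line `parity-count-second-quantised-fgr` (lead c12), in
the skeleton's stub namespace
`Summit.AtomisticToContinuum.FouriersLaw.Theorems.MourreDissolution.ParityCountSecondQuantisedFgr`.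

For `pinnedChain ω₂ lam β γ` (all four `> 0`) there is `T₀ > 0` (`T₀ = 1`; every `T > 0` works) such
that for every `T ∈ (0, T₀)` there are an infinite-volume dynamics `D` with `D.carrier = bmGood` whose
flow commutes with the lattice translations everywhere (the canonical symmetric Buttà–Marchioro
dynamics) and Doyon data `Z : ZeroWavenumberData (pinnedChain …) D` whose state is a DLR Gibbs state
at `T` carrying Ruelle's superstability estimate, momentum-reversal symmetric, with strongly
continuous Koopman group, for which the spatial reflection `ι : (σ_x) ↦ (σ_{-x})` is a symmetry
(preserves `Z.μ`, the carrier and `𝒱 = Z.localObs`, and commutes with the flow everywhere), and whose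
observable space contains all coordinates `q_x, p_x` and is closed under products.

Proof. The proof of the landed stub F
`DrudeDissolution.KineticPolymerGasOnTheTimeAxis.stub_richFramework` of the sibling line
`kinetic-polymer-gas-on-the-time-axis` re-run, exporting in addition the superstability estimate of
the transfer-operator Gibbs state (third component of `richFramework_clustering`) and the exact
`ι`-covariance of the flow (last component of `GramPencilHarmonicChaos.pencilFramework_dynamics`):
the dynamics from `pencilFramework_dynamics`, the clustering Gibbs state from
`richFramework_clustering`, square integrability of the multi-time monomials from
`richFramework_monomials`, and the datum from `richFramework_datum`.
-/

noncomputable section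

namespace Summit.AtomisticToContinuum.FouriersLaw.Theorems.MourreDissolution.ParityCountSecondQuantisedFgr

open MeasureTheory Set Filter Topology Function Real
open scoped InnerProductSpace ENNReal
open Literature.MathematicalPhysics.KineticTheory
open Literature.MathematicalPhysics.KineticTheory.HeatConduction
open Literature.MathematicalPhysics.KineticTheory.PhononBoltzmann
open Summit.AtomisticToContinuum.FouriersLaw.Theorems.DrudeDissolution.GramPencilHarmonicChaos
open Summit.AtomisticToContinuum.FouriersLaw.Theorems.DrudeDissolution.KineticPolymerGasOnTheTimeAxis

/-- **Stub B′ of line `parity-count-second-quantised-fgr` (`stub_framework`): the rich symmetric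
zero-wavenumber framework.**
For `pinnedChain ω₂ lam β γ` (all `> 0`) there is `T₀ > 0` (`T₀ = 1`; every `T > 0` works) such that
for `T ∈ (0, T₀)` there are an infinite-volume dynamics `D` with `D.carrier = bmGood` whose flow
commutes with the lattice translations everywhere (the canonical symmetric Buttà–Marchioro dynamics)
and Doyon data `Z : ZeroWavenumberData (pinnedChain …) D` whose state is a DLR Gibbs state at `T`
carrying the superstability estimate, momentum-reversal symmetric, with strongly continuous Koopman
group, for which the spatial reflection `ι : (σ_x) ↦ (σ_{-x})` is a symmetry (preserves `Z.μ`, the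
carrier and `𝒱`, and commutes with the flow everywhere), and whose observable space
`𝒱 = Z.localObs` contains all coordinates `q_x, p_x` and is closed under products.
The proof of `KineticPolymerGasOnTheTimeAxis.stub_richFramework` re-run, exporting in addition `hss`
of `richFramework_clustering` and `hrefl` of `pencilFramework_dynamics`.
[cite: Doyon2022, §4.1 Def. 4.3–4.4, Thm 4.11] [cite: ButtaMarchioro2016, §2 Thm 2.1–2.2 and §3] -/
theorem stub_framework :
    ∀ ω₂ lam β γ : ℝ, 0 < ω₂ → 0 < lam → 0 < β → 0 < γ →
      ∃ T₀ : ℝ, 0 < T₀ ∧ ∀ T : ℝ, 0 < T → T < T₀ →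
        ∃ (D : InfiniteChainDynamics (pinnedChain ω₂ lam β γ))
          (Z : ZeroWavenumberData (pinnedChain ω₂ lam β γ) D),
          D.carrier = (pinnedChain ω₂ lam β γ).bmGood ∧
          (∀ (t : ℝ) (x : ℤ), D.flow t ∘ chainShift x = chainShift x ∘ D.flow t) ∧
          (pinnedChain ω₂ lam β γ).IsChainGibbsMeasure T Z.μ ∧
          (pinnedChain ω₂ lam β γ).HasSuperstabilityEstimate Z.μ ∧
          Z.HasMomentumReversal ∧
          Z.toFluctuationDynamics.IsStronglyContinuous ∧
          MeasurePreserving (fun (σ : ChainConfig) (i : ℤ) => σ (-i)) Z.μ Z.μ ∧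
          Set.MapsTo (fun (σ : ChainConfig) (i : ℤ) => σ (-i)) D.carrier D.carrier ∧
          (∀ a ∈ Z.localObs, (a ∘ fun (σ : ChainConfig) (i : ℤ) => σ (-i)) ∈ Z.localObs) ∧
          (∀ t : ℝ, (fun (σ : ChainConfig) (i : ℤ) => σ (-i)) ∘ D.flow t =
            D.flow t ∘ fun (σ : ChainConfig) (i : ℤ) => σ (-i)) ∧
          (∀ x : ℤ, (fun σ : ChainConfig => (σ x).1) ∈ Z.localObs) ∧
          (∀ x : ℤ, (fun σ : ChainConfig => (σ x).2) ∈ Z.localObs) ∧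
          (∀ a ∈ Z.localObs, ∀ b ∈ Z.localObs, a * b ∈ Z.localObs) := by
  -- adapted from `KineticPolymerGasOnTheTimeAxis.stub_richFramework` (two extra conjuncts exported)
  intro ω₂ lam β γ hω hl hβ _hγ
  refine ⟨1, one_pos, fun T hT _ => ?_⟩
  -- the canonical symmetric Buttà–Marchioro dynamics (general `γ`)
  obtain ⟨D, hD, hm, hid, hgrp, -, hsh, hrev, hrefl⟩ :=
    pencilFramework_dynamics ω₂ lam β γ hω hl.le hβ.le
  have h0 : D.flow 0 = id := by
    funext σ
    by_cases hσ : σ ∈ (pinnedChain ω₂ lam β γ).bmGood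
    · exact D.flow_zero σ (by rw [hD]; exact hσ)
    · exact hid 0 σ hσ
  have hgrp' : ∀ t s : ℝ, D.flow (t + s) = D.flow t ∘ D.flow s := by
    intro t s
    funext σ
    by_cases hσ : σ ∈ (pinnedChain ω₂ lam β γ).bmGood
    · exact hgrp t s σ hσ
    · rw [comp_apply, hid (t + s) σ hσ, hid s σ hσ, hid t σ hσ]
  -- the clustering Gibbs state at temperature `T` (parts R-T, R-M, R-C), with its superstability estimate
  obtain ⟨μ, hG, hshift, hss, hιmap, hpres, hsum, hcont⟩ :=
    richFramework_clustering ω₂ lam β γ hω hl.le hβ.le T hT D hD hm hid hgrp' hsh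
  haveI := hG.isProbabilityMeasure
  have hmem : ∀ M ∈ Submonoid.closure {w : (ℤ → ℝ × ℝ) → ℝ | ∃ u ∈ Algebra.adjoin ℝ (Set.range
      fun xc : ℤ × Bool => fun σ : ChainConfig => if xc.2 then (σ xc.1).2 else (σ xc.1).1),
      ∃ s : ℝ, w = u ∘ D.flow s}, MemLp M 2 μ := fun M hM => by
    obtain ⟨hMm, hMmom, -⟩ :=
      richFramework_monomials ω₂ lam β γ hω hl.le hβ.le T hT D hD hm hid hgrp' μ hG hshift hss M hM
    exact memLp_two_of_abs_sq hMm (hMmom 2)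
  -- the rich datum
  obtain ⟨Z, hZμ, hMR, hsc, hι, hq, hp, hmul⟩ :=
    richFramework_datum D h0 hgrp' hsh hrev hrefl μ hpres hshift.measurePreserving_chainShift
      (MourreDissolution.measurePreserving_chainReversal_of_isChainGibbsMeasure hG) hmem hsum hcont
  refine ⟨D, Z, hD, hsh, (by rw [hZμ]; exact hG), (by rw [hZμ]; exact hss), hMR, hsc, ?_, ?_, hι,
    hrefl, hq, hp, hmul⟩
  · rw [hZμ]
    exact ⟨MourreDissolution.measurable_reflect, hιmap⟩
  · rw [hD]
    exact MourreDissolution.mapsTo_reflect_bmGood _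

end Summit.AtomisticToContinuum.FouriersLaw.Theorems.MourreDissolution.ParityCountSecondQuantisedFgr

end
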